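import Summits.CriticalPhenomena.PercolationContinuityZ3.Theorems.Transplant.BccClawX2TableOKA
import Summits.CriticalPhenomena.PercolationContinuityZ3.Theorems.Transplant.BccClawX2TableOKB
import Summits.CriticalPhenomena.PercolationContinuityZ3.Theorems.Transplant.BccClawX2TableOKC
import Summits.CriticalPhenomena.PercolationContinuityZ3.Theorems.Transplant.BccClawX2TableOKD
import Summits.CriticalPhenomena.PercolationContinuityZ3.Theorems.Transplant.BccClawX2TableOKE
import Summits.CriticalPhenomena.PercolationContinuityZ3.Theorems.Transplant.BccClawX2TableOKF
import Summits.CriticalPhenomena.PercolationContinuityZ3.Theorems.Transplant.BccClawX2TableOKG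
import Summits.CriticalPhenomena.PercolationContinuityZ3.Theorems.Transplant.BccClawX2TableOKH
import Summits.CriticalPhenomena.PercolationContinuityZ3.Theorems.Transplant.BccClawX2Sound
import Summits.CriticalPhenomena.PercolationContinuityZ3.Theorems.Transplant.BccClawXLegs
import HarnessLib

/-!
# The bcc (001)-slabs, exit-form routing certificate for THICKNESS `k = 2`, V: the EVEN-HUB PLANAR CLAW EXISTS for every admissible configuration of every
# clip class and both centre parities (from the `56` kernel theorems and the diagonal mirror), and the bridge from the tree's target columns

builds on p205010 (kernel theorem, internal audit signed; external expert review pending) — NOT used in this file.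
Lane `prim-bschramm`, seat `prim-bschramm-p2` (gen 47; class C1b, METHOD = input substitution; memo `HOME/bschramm/P2-LATTICES.md` §157); helper file
(`--supports stmt-CriticalPhenomena-4575 --as helper`).
* §1 `clawX2OK_three` (the `56` kernel theorems of «BccClawX2TableOK{A,…,H}» by cases), **`exists_claw2`** (every clip class: `t_R = 3` directly, `t_R < 3`
  through the diagonal mirror of «BccClawXSound»/«BccClawX2Sound», which preserves the centre parity);
* §2 **`exists_claw2_of_tgtCols`**: the tree form — target columns of «BccSlabClearedSetX», the twin side conditions of «BccSlabTwoCert».`ColRoutingTwin`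
  (plus evenness of the stacked column) — gives an even hub and a claw relative to the centre `z`, parity `ε = (z₀ + z₁) mod 2`.
[cite: DuminilCopinSidoraviciusTassion2016, §2.3 (proof of Fact 2: the three disjoint paths in B̄_R(z))]
-/

namespace Summit.CriticalPhenomena.PercolationContinuityZ3.Theorems.Transplant

namespace BccClawX

open Literature.Probability.Percolation Literature.Probability.LatticeModels SimpleGraph
open BccSlab (Dcols cornerCols extCols tgtCols mem_Dcols mem_cornerCols mem_extCols mem_tgtCols mem_sqBlkR_three_iff_linear)

/-! ## §1 The even-hub claw exists in the model -/

/-- **The parity-aware rule succeeds for every clip class with `t_R = 3` and both parities** (the `56` kernel theorems of «BccClawX2TableOK{A,…,H}»). [folklore] -/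
theorem clawX2OK_three {ε : ℤ} (hε : ε = 0 ∨ ε = 1) {cD cS cE : ℕ} (hD : 3 ≤ cD) (hD' : cD ≤ 4) (hS : cS ≤ 3) (hE : cE ≤ 4) (hSE : cS ≤ cE) :
    ClawX2OK ε 3 cD cS cE := by
  rcases hε with rfl | rfl <;> interval_cases cD <;> interval_cases cS <;> interval_cases cE
  exacts [
    clawX2OK_e0_3300, clawX2OK_e0_3301, clawX2OK_e0_3302, clawX2OK_e0_3303, clawX2OK_e0_3304, clawX2OK_e0_3311, clawX2OK_e0_3312, clawX2OK_e0_3313,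
    clawX2OK_e0_3314, clawX2OK_e0_3322, clawX2OK_e0_3323, clawX2OK_e0_3324, clawX2OK_e0_3333, clawX2OK_e0_3334, clawX2OK_e0_3400, clawX2OK_e0_3401,
    clawX2OK_e0_3402, clawX2OK_e0_3403, clawX2OK_e0_3404, clawX2OK_e0_3411, clawX2OK_e0_3412, clawX2OK_e0_3413, clawX2OK_e0_3414, clawX2OK_e0_3422,
    clawX2OK_e0_3423, clawX2OK_e0_3424, clawX2OK_e0_3433, clawX2OK_e0_3434, clawX2OK_e1_3300, clawX2OK_e1_3301, clawX2OK_e1_3302, clawX2OK_e1_3303,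
    clawX2OK_e1_3304, clawX2OK_e1_3311, clawX2OK_e1_3312, clawX2OK_e1_3313, clawX2OK_e1_3314, clawX2OK_e1_3322, clawX2OK_e1_3323, clawX2OK_e1_3324,
    clawX2OK_e1_3333, clawX2OK_e1_3334, clawX2OK_e1_3400, clawX2OK_e1_3401, clawX2OK_e1_3402, clawX2OK_e1_3403, clawX2OK_e1_3404, clawX2OK_e1_3411,
    clawX2OK_e1_3412, clawX2OK_e1_3413, clawX2OK_e1_3414, clawX2OK_e1_3422, clawX2OK_e1_3423, clawX2OK_e1_3424, clawX2OK_e1_3433, clawX2OK_e1_3434]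

/-- **THE EVEN-HUB CLAW EXISTS for every admissible configuration of every clip class and both parities** (codes `c_R ≤ 3`, `c_D ≤ 4`, `c_S ≤ 3`, `c_E ≤ 4`,
`c_R ≤ c_D`, `c_S ≤ c_E`, `c_R = 3 ∨ c_S = 3`): directly from the kernel theorems when `c_R = 3`, through the diagonal mirror when `c_R < 3`.
[cite: DuminilCopinSidoraviciusTassion2016, §2.3 (proof of Fact 2: the three disjoint paths)] -/
theorem exists_claw2 {ε : ℤ} (hε : ε = 0 ∨ ε = 1) {cR cD cS cE : ℕ} (hR : cR ≤ 3) (hD : cD ≤ 4) (hS : cS ≤ 3) (hE : cE ≤ 4) (hRD : cR ≤ cD) (hSE : cS ≤ cE)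
    (hone : cR = 3 ∨ cS = 3) {a1 a2 a3 : Pt} (h1 : a1 ∈ tgtRList cR cD cS cE) (h2 : a2 ∈ tgtRList cR cD cS cE) (h3 : a3 ∈ tgtList cD cE)
    (hadm : admissible2 ε cD cE a1 a2 a3 = true) :
    ∃ (q : Pt) (l1 l2 l3 : List Pt), evenb ε q = true ∧ ClawProps cR cD cS cE a1 a2 a3 q l1 l2 l3 := by
  by_cases h3R : cR = 3
  · subst h3R
    have := clawX2OK_three hε hRD hD hS hE hSE a1 h1 a2 h2 a3 h3 hadm
    obtain ⟨⟨q, l1, l2, l3⟩, hsome⟩ := Option.isSome_iff_exists.1 this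
    exact ⟨q, l1, l2, l3, clawX2_sound hsome⟩
  · have hS3 : cS = 3 := hone.resolve_left h3R
    subst hS3
    rw [tgtRList, List.mem_filter] at h1 h2
    rw [tgtList, List.mem_filter] at h3
    have h1' : sw a1 ∈ tgtRList 3 cE cR cD := by
      rw [tgtRList, List.mem_filter, isTgtR_sw]; exact ⟨sw_mem_allPts h1.1, h1.2⟩
    have h2' : sw a2 ∈ tgtRList 3 cE cR cD := by
      rw [tgtRList, List.mem_filter, isTgtR_sw]; exact ⟨sw_mem_allPts h2.1, h2.2⟩
    have h3' : sw a3 ∈ tgtList cE cD := by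
      rw [tgtList, List.mem_filter, Bool.and_eq_true, isTgt_sw, sw_beq_zero]; exact ⟨sw_mem_allPts h3.1, by simpa using h3.2⟩
    have hadm' : admissible2 ε cE cD (sw a1) (sw a2) (sw a3) = true := by rw [admissible2_sw]; exact hadm
    have := clawX2OK_three hε hSE hE hR hD hRD (sw a1) h1' (sw a2) h2' (sw a3) h3' hadm'
    obtain ⟨⟨q, l1, l2, l3⟩, hsome⟩ := Option.isSome_iff_exists.1 this
    obtain ⟨hev, hP⟩ := clawX2_sound hsome
    exact ⟨sw q, l1.map sw, l2.map sw, l3.map sw, by rw [evenb_sw]; exact hev, hP.unsw⟩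

/-! ## §2 The bridge to the tree -/

/-- Membership in the neighbour list is the adjacency test. [folklore] -/
theorem mem_nbrs_iff_adjb {a c : Pt} : c ∈ nbrs a ↔ adjb a c = true := by
  obtain ⟨a1, a2⟩ := a
  obtain ⟨c1, c2⟩ := c
  simp only [nbrs, List.mem_cons, List.not_mem_nil, or_false, Prod.mk.injEq, adjb, Bool.or_eq_true, Bool.and_eq_true, decide_eq_true_eq]
  omega

/-- A list with two distinct members has length at least two. [folklore] -/
theorem two_le_length_of_mem_ne {α : Type} {l : List α} {x y : α} (hx : x ∈ l) (hy : y ∈ l) (h : x ≠ y) : 2 ≤ l.length := by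
  match l, hx, hy with
  | [a], hx, hy =>
    rw [List.mem_singleton] at hx hy
    exact absurd (hx.trans hy.symm) h
  | _ :: _ :: _, _, _ => simp

/-- The centre parity code is `0` or `1`. [folklore] -/
theorem parity_code (z : Site 2) : (z 0 + z 1) % 2 = 0 ∨ (z 0 + z 1) % 2 = 1 := by omega

/-- **THE EVEN-HUB PLANAR CLAW for a column-certified triple with the twin side conditions** (tree form of the hypotheses — those of
«BccSlabTwoCert».`ColRoutingTwin` plus evenness of the stacked column —, model form of the conclusion, relative to `z`, parity `ε = (z₀ + z₁) mod 2`).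
[cite: DuminilCopinSidoraviciusTassion2016, §2.3 (proof of Fact 2: the three disjoint paths in B̄_R(z))] -/
theorem exists_claw2_of_tgtCols {z : Site 2} {tR tD sR sD : ℕ} (hRD : tR ≤ tD) (hSE : sR ≤ sD) (hone : 3 ≤ tR ∨ 3 ≤ sR) {a₁ a₂ a₃ : Site 2}
    (h1 : a₁ ∈ tgtCols z tD sD) (h1R : a₁ ∈ sqBlkR 3 z tR sR) (h1z : a₁ ≠ z) (h2 : a₂ ∈ tgtCols z tD sD) (h2R : a₂ ∈ sqBlkR 3 z tR sR) (h2z : a₂ ≠ z)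
    (h3 : a₃ ∈ tgtCols z tD sD) (h3z : a₃ ≠ z) (h31 : a₃ ≠ a₁) (h32 : a₃ ≠ a₂)
    (htwin : a₁ = a₂ → Even (a₁ 0 + a₁ 1) ∧ ¬ (zdGraph 2).Adj a₁ a₃ ∧
      ∃ O₁ O₂ : Site 2, O₁ ≠ O₂ ∧ (zdGraph 2).Adj a₁ O₁ ∧ (zdGraph 2).Adj a₁ O₂ ∧ O₁ ∈ extCols z tD sD ∧ O₂ ∈ extCols z tD sD) :
    ∃ (q : Pt) (l1 l2 l3 : List Pt), evenb ((z 0 + z 1) % 2) q = true ∧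
      ClawProps (min tR 3) (min tD 4) (min sR 3) (min sD 4) (rel z a₁) (rel z a₂) (rel z a₃) q l1 l2 l3 := by
  obtain ⟨cR, cD, cS, cE, cRD, cSE, cone⟩ := codes_ok hRD hSE hone
  refine exists_claw2 (parity_code z) cR cD cS cE cRD cSE cone (mem_tgtRList h1 h1R h1z) (mem_tgtRList h2 h2R h2z) (mem_tgtList h3 h3z) ?_
  have hne1 : rel z a₃ ≠ rel z a₁ := fun h => h31 (by rw [← pt_rel z a₃, h, pt_rel])
  have hne2 : rel z a₃ ≠ rel z a₂ := fun h => h32 (by rw [← pt_rel z a₃, h, pt_rel])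
  by_cases h12 : a₁ = a₂
  · obtain ⟨hev, hnadj, O₁, O₂, hO, hO₁, hO₂, hO₁e, hO₂e⟩ := htwin h12
    subst h12
    have hevb : evenb ((z 0 + z 1) % 2) (rel z a₁) = true := by
      obtain ⟨m, hm⟩ := hev
      simp only [evenb, rel, beq_iff_eq]
      omega
    have hcont : (nbrs (rel z a₁)).contains (rel z a₃) = false := by
      rw [Bool.eq_false_iff]
      intro hc
      have hmem : rel z a₃ ∈ nbrs (rel z a₁) := List.contains_iff_mem.1 hc
      exact hnadj (by have := (adjb_iff (z := z)).1 (mem_nbrs_iff_adjb.1 hmem); rwa [pt_rel, pt_rel] at this)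
    have hlen : 2 ≤ ((nbrs (rel z a₁)).filter (isExt (min tD 4) (min sD 4))).length := by
      have m1 : rel z O₁ ∈ (nbrs (rel z a₁)).filter (isExt (min tD 4) (min sD 4)) :=
        List.mem_filter.2 ⟨mem_nbrs_iff_adjb.2 (adjb_rel hO₁), isExt_rel h1.1 hO₁ hO₁e⟩
      have m2 : rel z O₂ ∈ (nbrs (rel z a₁)).filter (isExt (min tD 4) (min sD 4)) :=
        List.mem_filter.2 ⟨mem_nbrs_iff_adjb.2 (adjb_rel hO₂), isExt_rel h1.1 hO₂ hO₂e⟩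
      exact two_le_length_of_mem_ne m1 m2 (fun h => hO (by rw [← pt_rel z O₁, h, pt_rel]))
    simp only [admissible2, twinOK, Bool.and_eq_true, Bool.not_eq_true', beq_eq_false_iff_ne, ne_eq, Bool.or_eq_true, hevb, hcont,
      decide_eq_true_eq]
    exact ⟨⟨hne1, hne2⟩, Or.inr ⟨⟨trivial, trivial⟩, hlen⟩⟩
  · have hne12 : rel z a₁ ≠ rel z a₂ := fun h => h12 (by rw [← pt_rel z a₁, h, pt_rel])
    simp only [admissible2, Bool.and_eq_true, Bool.not_eq_true', beq_eq_false_iff_ne, ne_eq, Bool.or_eq_true]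
    exact ⟨⟨hne1, hne2⟩, Or.inl hne12⟩

end BccClawX

end Summit.CriticalPhenomena.PercolationContinuityZ3.Theorems.Transplant
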